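import Summits.Ventures.PercRepro.RankLevelSetRuleQCellFiveFalse

/-!
# PercRepro — SHARPER WALLIS BOUNDS ON THE CENTRAL BINOMIAL (night-1, gen 17; dossier §28.6)

The tree's bounds `C(2j,j)²·(3j+1) ≤ 16^j` (`centralBinom_sq_mul_le`) and `16^j ≤ C(2j,j)²·4j` (`centralBinom_sq_mul_ge`)
lose the factors `π/3` and `4/π` in `x² = 16^j/C(2j,j)² ≈ πj`. The same one-step induction
(`(j+1)·C(2j+2,j+1) = 2(2j+1)·C(2j,j)`) proves `C(2j,j)²·(aj+b) ≤ 16^j` whenever `4b ≥ a`, `3b ≥ a` and the base case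
holds, and `16^j ≤ C(2j,j)²·(aj+b)` whenever `4b ≤ a`, `3b ≤ a` and the base case holds; with the base case at `j = 8`:
* **`centralBinom_sq_mul_le'`** — `C(2j,j)²·(312j + 97) ≤ 100·16^j` for `j ≥ 8`, i.e. `x² ≥ 3.12j + 0.97`;
* **`centralBinom_sq_mul_ge'`** — `100·16^j ≤ C(2j,j)²·(315j + 74)` for `j ≥ 8`, i.e. `x² ≤ 3.15j + 0.74`.
(`π ≈ 3.1416`: the true `x²` is `πj + π/4 + O(1/j)`.) Needed for the borderline slices of the families `k ≥ 8`, where the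
crude bounds fail below the reach of the kernel cells (dossier §28). Axioms: standard.
-/

namespace PercRepro

/-- `C(16, 8) = 12870`. -/
lemma centralBinom_eight : (8 : ℕ).centralBinom = 12870 := by
  rw [Nat.centralBinom_eq_two_mul_choose]
  norm_num [Nat.choose_eq_factorial_div_factorial, Nat.factorial]

/-- **Wallis, sharper lower bound**: `C(2j,j)²·(312j + 97) ≤ 100·16^j` for `j ≥ 8` (the step is `(2j+1)²(312j+409) ≤
4(j+1)²(312j+97)`, i.e. `21 ≤ 76j`; the base `j = 8` is `165636900·2593 ≤ 42949672960·10`). -/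
lemma centralBinom_sq_mul_le' : ∀ j : ℕ, 8 ≤ j → j.centralBinom ^ 2 * (312 * j + 97) ≤ 100 * 16 ^ j := by
  intro j
  induction j with
  | zero => intro h; omega
  | succ j ih =>
    intro hj
    rcases Nat.lt_or_ge j 8 with hlt | hge
    · have h7 : j = 7 := by omega
      subst h7
      rw [show (7 : ℕ) + 1 = 8 by rfl, centralBinom_eight]
      norm_num
    · have ih' := ih hge
      have hrec := Nat.succ_mul_centralBinom_succ j
      have h1 : (j + 1) ^ 2 * (312 * j + 97) * ((j + 1).centralBinom ^ 2 * (312 * (j + 1) + 97))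
          = 4 * (2 * j + 1) ^ 2 * (312 * (j + 1) + 97) * (j.centralBinom ^ 2 * (312 * j + 97)) := by
        have : ((j + 1) * (j + 1).centralBinom) ^ 2 = (2 * (2 * j + 1) * j.centralBinom) ^ 2 := by rw [hrec]
        nlinarith [this]
      have h2 : 4 * (2 * j + 1) ^ 2 * (312 * (j + 1) + 97) * (j.centralBinom ^ 2 * (312 * j + 97))
          ≤ 4 * (2 * j + 1) ^ 2 * (312 * (j + 1) + 97) * (100 * 16 ^ j) :=
        Nat.mul_le_mul_left _ ih'
      have h3 : 4 * (2 * j + 1) ^ 2 * (312 * (j + 1) + 97) ≤ 16 * ((j + 1) ^ 2 * (312 * j + 97)) := by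
        nlinarith
      have h4 : (j + 1) ^ 2 * (312 * j + 97) * ((j + 1).centralBinom ^ 2 * (312 * (j + 1) + 97))
          ≤ (j + 1) ^ 2 * (312 * j + 97) * (100 * 16 ^ (j + 1)) := by
        calc (j + 1) ^ 2 * (312 * j + 97) * ((j + 1).centralBinom ^ 2 * (312 * (j + 1) + 97))
            = 4 * (2 * j + 1) ^ 2 * (312 * (j + 1) + 97) * (j.centralBinom ^ 2 * (312 * j + 97)) := h1
          _ ≤ 4 * (2 * j + 1) ^ 2 * (312 * (j + 1) + 97) * (100 * 16 ^ j) := h2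
          _ ≤ 16 * ((j + 1) ^ 2 * (312 * j + 97)) * (100 * 16 ^ j) := Nat.mul_le_mul_right _ h3
          _ = (j + 1) ^ 2 * (312 * j + 97) * (100 * 16 ^ (j + 1)) := by ring
      exact Nat.le_of_mul_le_mul_left h4 (by positivity)

/-- **Wallis, sharper upper bound**: `100·16^j ≤ C(2j,j)²·(315j + 74)` for `j ≥ 8` (the step is `4(j+1)²(315j+74) ≤
(2j+1)²(315j+389)`, i.e. `0 ≤ 19j + 93`; the base `j = 8` is `42949672960·10 ≤ 165636900·2594`). -/
lemma centralBinom_sq_mul_ge' : ∀ j : ℕ, 8 ≤ j → 100 * 16 ^ j ≤ j.centralBinom ^ 2 * (315 * j + 74) := by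
  intro j
  induction j with
  | zero => intro h; omega
  | succ j ih =>
    intro hj
    rcases Nat.lt_or_ge j 8 with hlt | hge
    · have h7 : j = 7 := by omega
      subst h7
      rw [show (7 : ℕ) + 1 = 8 by rfl, centralBinom_eight]
      norm_num
    · have ih' := ih hge
      have hrec := Nat.succ_mul_centralBinom_succ j
      have h1 : (j + 1) ^ 2 * ((j + 1).centralBinom ^ 2 * (315 * (j + 1) + 74))
          = 4 * (2 * j + 1) ^ 2 * (315 * (j + 1) + 74) * j.centralBinom ^ 2 := by
        have : ((j + 1) * (j + 1).centralBinom) ^ 2 = (2 * (2 * j + 1) * j.centralBinom) ^ 2 := by rw [hrec]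
        nlinarith [this]
      have h2 : (j + 1) ^ 2 * (100 * 16 ^ (j + 1)) ≤ (j + 1) ^ 2 * ((j + 1).centralBinom ^ 2 * (315 * (j + 1) + 74)) := by
        rw [h1]
        calc (j + 1) ^ 2 * (100 * 16 ^ (j + 1)) = 16 * (j + 1) ^ 2 * (100 * 16 ^ j) := by ring
          _ ≤ 16 * (j + 1) ^ 2 * (j.centralBinom ^ 2 * (315 * j + 74)) := Nat.mul_le_mul_left _ ih'
          _ = (4 * (j + 1) ^ 2 * (315 * j + 74)) * (4 * j.centralBinom ^ 2) := by ring
          _ ≤ ((2 * j + 1) ^ 2 * (315 * (j + 1) + 74)) * (4 * j.centralBinom ^ 2) := by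
              apply Nat.mul_le_mul_right
              nlinarith
          _ = 4 * (2 * j + 1) ^ 2 * (315 * (j + 1) + 74) * j.centralBinom ^ 2 := by ring
      exact Nat.le_of_mul_le_mul_left h2 (by positivity)

end PercRepro
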